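import Summits.MatrixMultiplication.OmegaCensus.DihedralLawAttainedQuotCyclic
import Summits.MatrixMultiplication.OmegaCensus.DicyclicLawModOne
import HarnessLib

/-!
# Lifting TPP triples from the dihedral quotient: the dicyclic law `3V + 16 = 8|A|` is attained whenever
# `Dih(A/⟨c₀⟩)` attains its mod-one law — in particular whenever `A/⟨c₀⟩` has a cyclic subgroup of index `≤ 2`

ω-census `pub-omega`, family (b3), seat pub-omega-group gen 11.  Framing: lottery ticket; floor = certified bounds/negative
ranges.  VALUE: kernel theorems about the group-theoretic method (TPP capacity of dihedral-like groups); NOT progress on ω.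

Let `G(A, c₀)` be dihedral-like of dicyclic type (`c₀ ≠ 0`, so `2c₀ = 0`), `N = |A| ≡ 2 (mod 3)`, `N ≥ 14`.  The kernel knows
`3|S||T||U| + 16 ≤ 8N` for every TPP triple (`tpp_volume_le_law_dicyclicLike`), with equality ("the dicyclic law",
`V = 8⌊N/3⌋`) for `Q_{4n}` (`A` cyclic) and `ℤ_n ⋊ ℤ₄`, `C₂ × Q_{4m}`, `C₂ × (ℤ_n ⋊ ℤ₄)` (concrete families).  This file
gives the uniform mechanism behind all of them and new rows:

* `DihedralLikeGroup.exists_map`: a homomorphism `π : A →+ B` with `π c₀ = c₀'` induces `G(A, c₀) →* G(B, c₀')`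
  (`ρa ↦ ρ(πa)`, `τa ↦ τ(πa)`); for surjective `π` every TPP triple of `G(B, c₀')` lifts to one of `G(A, c₀)` of volume
  `|ker π| · V` (`tpp_volume_ge_of_map`: full preimage of `S`, sections of `T`, `U`; `tpp_lift`).  So
  **`β(G(A, c₀)) ≥ |ker π| · β(G(B, π c₀))`**, e.g. `β(G(A, c₀)) ≥ 2 β(Dih(A/⟨c₀⟩))`.
* `dicyclic_law_attained_of_quot` (abstract presentation form): if `π : A →+ B` is surjective with kernel `{0, c₀}` and
  `B = ⟨g⟩ ∪ (c + ⟨g⟩)` for some `g` and some `c` with `2c = 0` (i.e. `A/⟨c₀⟩` is cyclic or `ℤ₂ × ℤ_m`), then `G` has a TPP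
  triple with `3|S||T||U| + 16 = 8|A|`: `Dih(B)` attains its mod-one law (`dih_mod_one_law_attained_of_quot_cyclic`,
  `|B| = N/2 ≡ 1 (mod 3)`) and the triple lifts with a factor `2`.  With the upper bound: `dicyclic_law_iff_of_quot`
  (`β(G) = 8⌊N/3⌋` exactly, both halves).
* New concrete rows: **`β(G(ℤ₄ × ℤ_{2m}, (2,0))) = 8⌊8m/3⌋` for every `m ≡ 1 (mod 3)`** (`z4_z2m_dicyclic_law`; these
  groups `ℤ_{2m} ⋊ Q₈` have `A/⟨c₀⟩ ≅ ℤ₂ × ℤ_{2m}` but NO direct factor `C₂`, so they are not covered by the product rows),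
  e.g. `β(G(ℤ₄ × ℤ₈, (2,0))) = 80` at order `64`; and the uniform statement `dicyclic_law_of_quot_cyclic`
  (`A/⟨c₀⟩` cyclic ⇒ `β = 8⌊N/3⌋`, re-deriving the `Q_{4n}` and `ℤ_n ⋊ ℤ₄` rows at `N ≡ 2 (mod 3)` in one statement).

Remark (not used): the converse "dicyclic law attained ⇒ `Dih(A/⟨c₀⟩)` attains its mod-one law" is the open half of the
`|A| ≡ 2 (mod 3)` classification (smallest undecided cell `C₂² × Q₁₆`, `A/⟨c₀⟩ = ℤ₂² × ℤ₄`).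
-/

namespace Summit.MatrixMultiplication.OmegaCensus

open Literature.Combinatorics.Additive Finset

/-! ## Functoriality of the model and the lift -/

namespace DihedralLikeGroup

variable {A B : Type} [AddCommGroup A] [AddCommGroup B] {c₀ : A} {c₀' : B}
  [Fact (c₀ + c₀ = 0)] [Fact (c₀' + c₀' = 0)]

/-- **Functoriality**: `π : A →+ B` with `π c₀ = c₀'` induces a homomorphism `G(A, c₀) →* G(B, c₀')`,
`ρa ↦ ρ(πa)`, `τa ↦ τ(πa)` (the four relations are preserved since `π` is additive and `π c₀ = c₀'`). [folklore] -/
theorem exists_map (π : A →+ B) (hπ : π c₀ = c₀') :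
    ∃ f : DihedralLikeGroup A c₀ →* DihedralLikeGroup B c₀',
      (∀ a, f (rho a) = rho (π a)) ∧ ∀ a, f (tau a) = tau (π a) := by
  refine ⟨MonoidHom.mk' (fun g => DihedralLikeGroup.rec (motive := fun _ => DihedralLikeGroup B c₀')
      (fun a => rho (π a)) (fun a => tau (π a)) g) ?_, fun a => rfl, fun a => rfl⟩
  rintro (a | a) (b | b)
  · show rho (π (a + b)) = rho (π a + π b); rw [map_add]
  · show tau (π (b - a)) = tau (π b - π a); rw [map_sub]
  · show tau (π (a + b)) = tau (π a + π b); rw [map_add]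
  · show rho (π (c₀ + b - a)) = rho (c₀' + π b - π a); rw [map_sub, map_add, hπ]

/-- For a surjective `π : A →+ B` of finite groups, `|ker π| · |B| = |A|` (all fibres have the size of the kernel).
[folklore] -/
theorem card_ker_mul_card [Fintype A] [Fintype B] [DecidableEq B] (π : A →+ B) (hsurj : Function.Surjective π) :
    (univ.filter fun a : A => π a = 0).card * Fintype.card B = Fintype.card A := by
  classical
  rw [← Finset.card_univ (α := A), Finset.card_eq_sum_card_fiberwise (f := π) (s := univ) (t := univ)
    (fun a _ => mem_univ _)]
  rw [Finset.sum_const_nat (m := (univ.filter fun a : A => π a = 0).card) fun y _ => ?_, mul_comm, card_univ]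
  exact AddMonoidHom.card_fiber_eq_of_mem_range π (hsurj y) (hsurj 0)

/-- **Lifting through `map π`.**  For a surjective `π : A →+ B` with `π c₀ = c₀'`, every TPP triple `(S, T, U)` of
`G(B, c₀')` lifts to a TPP triple of `G(A, c₀)` of volume `|ker π| · |S||T||U|` (full preimage of `S`, sections of `T` and
`U`). [folklore] -/
theorem tpp_volume_ge_of_map [Fintype A] [DecidableEq A] [DecidableEq B] (π : A →+ B) (hπ : π c₀ = c₀')
    (hsurj : Function.Surjective π) {S T U : Finset (DihedralLikeGroup B c₀')} (h : TripleProductProperty S T U) :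
    ∃ S' T' U' : Finset (DihedralLikeGroup A c₀), TripleProductProperty S' T' U' ∧
      S'.card * T'.card * U'.card = (univ.filter fun a : A => π a = 0).card * (S.card * T.card * U.card) := by
  obtain ⟨f, hfρ, hfτ⟩ := exists_map (c₀ := c₀) (c₀' := c₀') π hπ
  -- a set-theoretic section of `π` and of `f`
  let sec : B → A := Function.surjInv hsurj
  have hsec : ∀ b, π (sec b) = b := Function.surjInv_eq hsurj
  let σ : DihedralLikeGroup B c₀' → DihedralLikeGroup A c₀ := fun g =>
    match g with
    | rho b => rho (sec b)
    | tau b => tau (sec b)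
  have hfσ : ∀ g, f (σ g) = g := by
    rintro (b | b)
    · show f (rho (sec b)) = rho b; rw [hfρ, hsec]
    · show f (tau (sec b)) = tau b; rw [hfτ, hsec]
  have hσinj : Function.Injective σ := fun g g' hgg' => by rw [← hfσ g, ← hfσ g', hgg']
  set Kf : Finset A := univ.filter fun a : A => π a = 0 with hKf
  -- the lift: `S' = σ(S) · ρ(ker π)`, `T' = σ(T)`, `U' = σ(U)`
  let lift : DihedralLikeGroup B c₀' × A → DihedralLikeGroup A c₀ := fun p => σ p.1 * rho p.2
  have hflift : ∀ p : DihedralLikeGroup B c₀' × A, p.2 ∈ Kf → f (lift p) = p.1 := by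
    rintro ⟨g, a⟩ ha
    have ha0 : π a = 0 := (mem_filter.1 ha).2
    show f (σ g * rho a) = g
    rw [map_mul, hfσ, hfρ, ha0, ← one_def, mul_one]
  have hlift_inj : Set.InjOn lift ↑(S ×ˢ Kf) := by
    rintro ⟨g, a⟩ hp ⟨g', a'⟩ hp' heq
    have ha := (mem_product.1 (mem_coe.1 hp)).2
    have ha' := (mem_product.1 (mem_coe.1 hp')).2
    have hg : g = g' := by
      have := congrArg f heq
      rwa [hflift ⟨g, a⟩ ha, hflift ⟨g', a'⟩ ha'] at this
    subst hg
    have hρ : (rho a : DihedralLikeGroup A c₀) = rho a' := mul_left_cancel heq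
    rw [rho_injective hρ]
  refine ⟨(S ×ˢ Kf).image lift, T.image σ, U.image σ, ?_, ?_⟩
  · refine tpp_lift f h ?_ ?_ ?_ ?_ ?_
    · intro x hx
      obtain ⟨p, hp, rfl⟩ := mem_image.1 hx
      rw [hflift p (mem_product.1 hp).2]; exact (mem_product.1 hp).1
    · intro x hx; obtain ⟨t, ht, rfl⟩ := mem_image.1 hx; rw [hfσ]; exact ht
    · intro x hx; obtain ⟨u, hu, rfl⟩ := mem_image.1 hx; rw [hfσ]; exact hu
    · rintro x hx y hy hxy
      obtain ⟨t, -, rfl⟩ := mem_image.1 (mem_coe.1 hx)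
      obtain ⟨t', -, rfl⟩ := mem_image.1 (mem_coe.1 hy)
      rw [hfσ, hfσ] at hxy; rw [hxy]
    · rintro x hx y hy hxy
      obtain ⟨u, -, rfl⟩ := mem_image.1 (mem_coe.1 hx)
      obtain ⟨u', -, rfl⟩ := mem_image.1 (mem_coe.1 hy)
      rw [hfσ, hfσ] at hxy; rw [hxy]
  · rw [card_image_of_injOn hlift_inj, card_product, card_image_of_injective _ hσinj,
      card_image_of_injective _ hσinj]
    ring

end DihedralLikeGroup

/-! ## The dicyclic law is attained when `Dih(A/⟨c₀⟩)` attains its mod-one law -/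

section Abstract

variable {A : Type} [AddCommGroup A] [DecidableEq A] [Fintype A] {G : Type} [Group G] [DecidableEq G]
  {ρ τ : A → G} {c₀ : A} {B : Type} [AddCommGroup B] [DecidableEq B] [Fintype B]

/-- A surjection with kernel `{0, c₀}`, `c₀ ≠ 0`, halves the order: `2|B| = |A|`. [folklore] -/
theorem card_eq_two_mul_of_ker_pair (π : A →+ B) (hsurj : Function.Surjective π) (hc₀ : c₀ ≠ 0)
    (hker : ∀ a : A, π a = 0 ↔ a = 0 ∨ a = c₀) : Fintype.card A = 2 * Fintype.card B := by
  have hK : (univ.filter fun a : A => π a = 0) = {0, c₀} := by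
    ext a; simp only [mem_filter, mem_univ, true_and, mem_insert, mem_singleton, hker]
  have key := DihedralLikeGroup.card_ker_mul_card π hsurj
  rw [hK, card_pair (Ne.symm hc₀)] at key
  omega

/-- **The dicyclic law is attained when the quotient is cyclic-by-at-most-2.**  Dihedral-like presentation over `(A, c₀)`
with `c₀ ≠ 0`, `|A| ≡ 2 (mod 3)`, `|A| ≥ 14`; `π : A →+ B` surjective with kernel `{0, c₀}` (so `B ≅ A/⟨c₀⟩`), and
`B = ⟨g⟩ ∪ (c + ⟨g⟩)` with `2c = 0` (`B` cyclic, or `ℤ₂ × ℤ_m`).  Then some TPP triple has `3|S||T||U| + 16 = 8|A|`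
(lift of a mod-one law triple of `Dih(B)`). [folklore] -/
theorem dicyclic_law_attained_of_quot
    (hρρ : ∀ a b, ρ a * ρ b = ρ (a + b)) (hρτ : ∀ a b, ρ a * τ b = τ (b - a))
    (hτρ : ∀ a b, τ a * ρ b = τ (a + b)) (hττ : ∀ a b, τ a * τ b = ρ (c₀ + b - a)) (hc₀ : c₀ ≠ 0)
    (hρ : Function.Injective ρ) (hτ : Function.Injective τ) (hne : ∀ a b, ρ a ≠ τ b)
    (hsurj : ∀ g, (∃ a, ρ a = g) ∨ (∃ a, τ a = g)) (hmod : Fintype.card A % 3 = 2) (hA : 14 ≤ Fintype.card A)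
    (π : A →+ B) (hπ : Function.Surjective π) (hker : ∀ a : A, π a = 0 ↔ a = 0 ∨ a = c₀)
    {c g : B} (h2c : c + c = 0) (hg : ∀ x : B, x ∈ AddSubgroup.zmultiples g ∨ x + c ∈ AddSubgroup.zmultiples g) :
    ∃ S T U : Finset G, TripleProductProperty S T U ∧ 3 * (S.card * T.card * U.card) + 16 = 8 * Fintype.card A := by
  have h2c₀ : c₀ + c₀ = 0 := two_c0_eq_zero hρτ hτρ hττ hτ
  haveI : Fact (c₀ + c₀ = 0) := ⟨h2c₀⟩
  haveI : Fact ((0 : B) + 0 = 0) := ⟨add_zero 0⟩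
  have hπc : π c₀ = 0 := (hker c₀).2 (Or.inr rfl)
  have hcard : Fintype.card A = 2 * Fintype.card B := card_eq_two_mul_of_ker_pair π hπ hc₀ hker
  have hK : (univ.filter fun a : A => π a = 0).card = 2 := by
    have : (univ.filter fun a : A => π a = 0) = {0, c₀} := by
      ext a; simp only [mem_filter, mem_univ, true_and, mem_insert, mem_singleton, hker]
    rw [this, card_pair (Ne.symm hc₀)]
  -- the mod-one law triple of `Dih(B)` (model presentation `rho, tau` over `(B, 0)`)
  obtain ⟨S, T, U, h, hV⟩ := dih_mod_one_law_attained_of_quot_cyclic (A := B) (G := DihedralLikeGroup B 0)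
    (ρ := DihedralLikeGroup.rho) (τ := DihedralLikeGroup.tau)
    DihedralLikeGroup.rho_mul_rho DihedralLikeGroup.rho_mul_tau DihedralLikeGroup.tau_mul_rho
    DihedralLikeGroup.tau_mul_tau DihedralLikeGroup.rho_injective DihedralLikeGroup.tau_injective
    DihedralLikeGroup.rho_ne_tau DihedralLikeGroup.rho_or_tau (by omega) (by omega) h2c hg
  -- lift to the model `G(A, c₀)` and transport to `G`
  obtain ⟨S', T', U', h', hV'⟩ := DihedralLikeGroup.tpp_volume_ge_of_map (c₀ := c₀) (c₀' := (0 : B)) π hπc hπ h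
  let eG : DihedralLikeGroup A c₀ ≃* G := DihedralLikeGroup.equivOfPresentation hρρ hρτ hτρ hττ hρ hτ hne hsurj
  obtain ⟨S'', T'', U'', h'', hV''⟩ := exists_tpp_volume_of_mulEquiv eG ⟨S', T', U', h', rfl⟩
  refine ⟨S'', T'', U'', h'', ?_⟩
  rw [hV'', hV', hK, hcard]
  omega

/-- **The dicyclic law, both halves, when `A/⟨c₀⟩` is cyclic-by-at-most-2** (`c₀ ≠ 0`, `|A| ≡ 2 (mod 3)`, `|A| ≥ 14`):
every TPP triple has `3|S||T||U| + 16 ≤ 8|A|` and some triple attains it, i.e. `β(G) = 8⌊|A|/3⌋`. [folklore] -/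
theorem dicyclic_law_iff_of_quot
    (hρρ : ∀ a b, ρ a * ρ b = ρ (a + b)) (hρτ : ∀ a b, ρ a * τ b = τ (b - a))
    (hτρ : ∀ a b, τ a * ρ b = τ (a + b)) (hττ : ∀ a b, τ a * τ b = ρ (c₀ + b - a)) (hc₀ : c₀ ≠ 0)
    (hρ : Function.Injective ρ) (hτ : Function.Injective τ) (hne : ∀ a b, ρ a ≠ τ b)
    (hsurj : ∀ g, (∃ a, ρ a = g) ∨ (∃ a, τ a = g)) (hmod : Fintype.card A % 3 = 2) (hA : 14 ≤ Fintype.card A)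
    (π : A →+ B) (hπ : Function.Surjective π) (hker : ∀ a : A, π a = 0 ↔ a = 0 ∨ a = c₀)
    {c g : B} (h2c : c + c = 0) (hg : ∀ x : B, x ∈ AddSubgroup.zmultiples g ∨ x + c ∈ AddSubgroup.zmultiples g) :
    (∀ S T U : Finset G, TripleProductProperty S T U → 3 * (S.card * T.card * U.card) + 16 ≤ 8 * Fintype.card A) ∧
    ∃ S T U : Finset G, TripleProductProperty S T U ∧ 3 * (S.card * T.card * U.card) + 16 = 8 * Fintype.card A :=
  ⟨fun _ _ _ h => tpp_volume_le_law_dicyclicLike hρρ hρτ hτρ hττ hρ hτ hne hsurj (two_c0_eq_zero hρτ hτρ hττ hτ) hc₀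
    hmod hA h,
   dicyclic_law_attained_of_quot hρρ hρτ hτρ hττ hc₀ hρ hτ hne hsurj hmod hA π hπ hker h2c hg⟩

/-- **`A/⟨c₀⟩` cyclic ⇒ the dicyclic law** (`c₀ ≠ 0`, `|A| ≡ 2 (mod 3)`, `|A| ≥ 14`; the condition is stated as
`A = ⟨a⟩ ∪ (c₀ + ⟨a⟩)`): `β(G) = 8⌊|A|/3⌋` — one statement for `Q_{4n}` (`A` cyclic) and `ℤ_n ⋊ ℤ₄`
(`A = ℤ₂ × ℤ_n`, `c₀ = (1,0)`) at `|A| ≡ 2 (mod 3)`. [folklore] -/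
theorem dicyclic_law_of_quot_cyclic
    (hρρ : ∀ a b, ρ a * ρ b = ρ (a + b)) (hρτ : ∀ a b, ρ a * τ b = τ (b - a))
    (hτρ : ∀ a b, τ a * ρ b = τ (a + b)) (hττ : ∀ a b, τ a * τ b = ρ (c₀ + b - a)) (hc₀ : c₀ ≠ 0)
    (hρ : Function.Injective ρ) (hτ : Function.Injective τ) (hne : ∀ a b, ρ a ≠ τ b)
    (hsurj : ∀ g, (∃ a, ρ a = g) ∨ (∃ a, τ a = g)) (hmod : Fintype.card A % 3 = 2) (hA : 14 ≤ Fintype.card A)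
    {a : A} (ha : ∀ x : A, x ∈ AddSubgroup.zmultiples a ∨ x + c₀ ∈ AddSubgroup.zmultiples a) :
    (∀ S T U : Finset G, TripleProductProperty S T U → 3 * (S.card * T.card * U.card) + 16 ≤ 8 * Fintype.card A) ∧
    ∃ S T U : Finset G, TripleProductProperty S T U ∧ 3 * (S.card * T.card * U.card) + 16 = 8 * Fintype.card A := by
  -- the quotient map `π : A → A/⟨c₀⟩`; its image of `a` generates
  let K : AddSubgroup A := AddSubgroup.zmultiples c₀
  let π : A →+ A ⧸ K := QuotientAddGroup.mk' K
  have h2c₀ : c₀ + c₀ = 0 := two_c0_eq_zero hρτ hτρ hττ hτ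
  have hker : ∀ x : A, π x = 0 ↔ x = 0 ∨ x = c₀ := by
    intro x
    rw [QuotientAddGroup.mk'_apply, QuotientAddGroup.eq_zero_iff]
    constructor
    · intro hx
      obtain ⟨k, hk⟩ := AddSubgroup.mem_zmultiples_iff.1 hx
      -- `k • c₀ ∈ {0, c₀}` since `2c₀ = 0`
      have hjj : ∀ j : ℤ, j • c₀ + j • c₀ = 0 := fun j => by rw [← zsmul_add, h2c₀, zsmul_zero]
      rcases Int.even_or_odd k with ⟨j, rfl⟩ | ⟨j, rfl⟩
      · left; rw [← hk, add_zsmul, hjj]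
      · right; rw [← hk, add_zsmul, one_zsmul, two_mul, add_zsmul, hjj, zero_add]
    · rintro (h0 | h0) <;> rw [h0]
      · exact K.zero_mem
      · exact AddSubgroup.mem_zmultiples c₀
  classical
  refine dicyclic_law_iff_of_quot hρρ hρτ hτρ hττ hc₀ hρ hτ hne hsurj hmod hA π
    (QuotientAddGroup.mk'_surjective K) hker (c := (0 : A ⧸ K)) (g := π a) (add_zero 0) fun x => ?_
  obtain ⟨y, rfl⟩ := QuotientAddGroup.mk'_surjective K x
  rcases ha y with hy | hy
  · left
    obtain ⟨k, hk⟩ := AddSubgroup.mem_zmultiples_iff.1 hy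
    exact AddSubgroup.mem_zmultiples_iff.2 ⟨k, by rw [← hk, map_zsmul]⟩
  · left
    obtain ⟨k, hk⟩ := AddSubgroup.mem_zmultiples_iff.1 hy
    refine AddSubgroup.mem_zmultiples_iff.2 ⟨k, ?_⟩
    have hπc : π c₀ = 0 := (hker c₀).2 (Or.inr rfl)
    rw [← map_zsmul, hk, map_add, hπc, add_zero]

end Abstract

/-! ## New rows: `G(ℤ₄ × ℤ_{2m}, (2,0)) = ℤ_{2m} ⋊ Q₈` -/

section Z4

variable {m : ℕ} [NeZero m] {G : Type} [Group G] [DecidableEq G] {ρ τ : ZMod 4 × ZMod (2 * m) → G}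

omit [NeZero m] in
/-- The reduction `ℤ₄ → ℤ₂` kills exactly `0` and `2` (`decide`). [folklore] -/
theorem cast42_eq_zero_iff : ∀ x : ZMod 4, ZMod.castHom (show 2 ∣ 4 by norm_num) (ZMod 2) x = 0 ↔ (x = 0 ∨ x = 2) := by
  decide

omit [NeZero m] in
/-- The reduction `ℤ₄ → ℤ₂` is onto (`decide`). [folklore] -/
theorem cast42_surjective : ∀ y : ZMod 2, ∃ x : ZMod 4, ZMod.castHom (show 2 ∣ 4 by norm_num) (ZMod 2) x = y := by
  decide

/-- **`β(G(ℤ₄ × ℤ_{2m}, (2,0))) = 8⌊8m/3⌋` for every `m ≡ 1 (mod 3)`** — any group with a dihedral-like presentation over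
`(ℤ₄ × ℤ_{2m}, (2,0))` (order `16m`, the groups `ℤ_{2m} ⋊ Q₈`; concretely `DihedralLikeGroup (ZMod 4 × ZMod (2m)) (2,0)`):
`A/⟨c₀⟩ ≅ ℤ₂ × ℤ_{2m}` via `(x, y) ↦ (x mod 2, y)`, so the dicyclic law is attained (lift of the mod-one law triple of
`C₂ × D_{4m}`) and is the upper bound (`|A| = 8m ≡ 2 (mod 3)`); e.g. `β = 80` at order `64` (`m = 4`), `208` at order `160`.
These `A` have no direct factor `C₂`, so the rows are not instances of the product rows `C₂ × G`. [folklore] -/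
theorem z4_z2m_dicyclic_law
    (hρρ : ∀ a b, ρ a * ρ b = ρ (a + b)) (hρτ : ∀ a b, ρ a * τ b = τ (b - a))
    (hτρ : ∀ a b, τ a * ρ b = τ (a + b)) (hττ : ∀ a b, τ a * τ b = ρ (((2 : ZMod 4), (0 : ZMod (2 * m))) + b - a))
    (hρ : Function.Injective ρ) (hτ : Function.Injective τ) (hne : ∀ a b, ρ a ≠ τ b)
    (hsurj : ∀ g, (∃ a, ρ a = g) ∨ (∃ a, τ a = g)) (hm : m % 3 = 1) (hm2 : 2 ≤ m) :
    (∀ S T U : Finset G, TripleProductProperty S T U → S.card * T.card * U.card ≤ 8 * (8 * m / 3)) ∧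
    ∃ S T U : Finset G, TripleProductProperty S T U ∧ S.card * T.card * U.card = 8 * (8 * m / 3) := by
  have hcard : Fintype.card (ZMod 4 × ZMod (2 * m)) = 8 * m := by
    rw [Fintype.card_prod, ZMod.card, ZMod.card]; ring
  have hc₀ : ((2 : ZMod 4), (0 : ZMod (2 * m))) ≠ 0 := by
    intro h
    have h1 : (2 : ZMod 4) = 0 := congrArg Prod.fst h
    exact absurd h1 (by decide)
  -- the projection `π : ℤ₄ × ℤ_{2m} →+ ℤ₂ × ℤ_{2m}`, `(x, y) ↦ (x mod 2, y)`
  let π : ZMod 4 × ZMod (2 * m) →+ ZMod 2 × ZMod (2 * m) :=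
    (ZMod.castHom (show 2 ∣ 4 by norm_num) (ZMod 2)).toAddMonoidHom.prodMap (AddMonoidHom.id _)
  have hπapp : ∀ p : ZMod 4 × ZMod (2 * m),
      π p = (ZMod.castHom (show 2 ∣ 4 by norm_num) (ZMod 2) p.1, p.2) := fun p => rfl
  have hsurjπ : Function.Surjective π := by
    rintro ⟨x, y⟩
    obtain ⟨x', hx'⟩ := cast42_surjective x
    exact ⟨(x', y), by rw [hπapp, hx']⟩
  have hker : ∀ a : ZMod 4 × ZMod (2 * m), π a = 0 ↔ a = 0 ∨ a = ((2 : ZMod 4), (0 : ZMod (2 * m))) := by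
    rintro ⟨x, y⟩
    rw [hπapp, Prod.mk_eq_zero, cast42_eq_zero_iff, Prod.mk_eq_zero, Prod.mk.injEq]
    tauto
  -- `ℤ₂ × ℤ_{2m} = ⟨(0,1)⟩ ∪ ((1,0) + ⟨(0,1)⟩)`
  have hg : ∀ x : ZMod 2 × ZMod (2 * m), x ∈ AddSubgroup.zmultiples ((0 : ZMod 2), (1 : ZMod (2 * m))) ∨
      x + ((1 : ZMod 2), (0 : ZMod (2 * m))) ∈ AddSubgroup.zmultiples ((0 : ZMod 2), (1 : ZMod (2 * m))) := by
    rintro ⟨x, y⟩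
    have hy : ((0 : ZMod 2), y) ∈ AddSubgroup.zmultiples ((0 : ZMod 2), (1 : ZMod (2 * m))) :=
      AddSubgroup.mem_zmultiples_iff.2 ⟨(y.val : ℤ), Prod.ext (by simp) (by
        simp only [Prod.smul_mk, natCast_zsmul, nsmul_eq_mul, mul_one, ZMod.natCast_zmod_val])⟩
    rcases (show ∀ z : ZMod 2, z = 0 ∨ z = 1 by decide) x with rfl | rfl
    · left; exact hy
    · right
      have : ((1 : ZMod 2), y) + ((1 : ZMod 2), (0 : ZMod (2 * m))) = ((0 : ZMod 2), y) :=
        Prod.ext (by show (1 : ZMod 2) + 1 = 0; decide) (by simp)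
      rw [this]; exact hy
  have key := dicyclic_law_iff_of_quot hρρ hρτ hτρ hττ hc₀ hρ hτ hne hsurj (by rw [hcard]; omega)
    (by rw [hcard]; omega) π hsurjπ hker (c := ((1 : ZMod 2), (0 : ZMod (2 * m))))
    (g := ((0 : ZMod 2), (1 : ZMod (2 * m)))) (Prod.ext (by show (1 : ZMod 2) + 1 = 0; decide) (by simp)) hg
  rw [hcard] at key
  obtain ⟨hle, S, T, U, h, hV⟩ := key
  refine ⟨fun S T U h' => ?_, S, T, U, h, ?_⟩
  · have := hle S T U h'; omega
  · omega

/-- The order-`64` instance in the model: **`β(DihedralLikeGroup (ℤ₄ × ℤ₈) (2,0)) = 80`** (`= ℤ₈ ⋊ Q₈`; the dicyclic law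
`(8·32 − 16)/3`).  Compare `β(C₂² × Q₁₆) ∈ [64, 80]` (same order, quotient `ℤ₂² × ℤ₄`, open). [folklore] -/
theorem z4_z8_dicyclic_law [Fact (((2 : ZMod 4), (0 : ZMod (2 * 4))) + ((2 : ZMod 4), (0 : ZMod (2 * 4))) = 0)] :
    (∀ S T U : Finset (DihedralLikeGroup (ZMod 4 × ZMod (2 * 4)) (2, 0)), TripleProductProperty S T U →
        S.card * T.card * U.card ≤ 80) ∧
    ∃ S T U : Finset (DihedralLikeGroup (ZMod 4 × ZMod (2 * 4)) (2, 0)), TripleProductProperty S T U ∧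
      S.card * T.card * U.card = 80 :=
  z4_z2m_dicyclic_law (m := 4) DihedralLikeGroup.rho_mul_rho DihedralLikeGroup.rho_mul_tau DihedralLikeGroup.tau_mul_rho
    DihedralLikeGroup.tau_mul_tau DihedralLikeGroup.rho_injective DihedralLikeGroup.tau_injective
    DihedralLikeGroup.rho_ne_tau DihedralLikeGroup.rho_or_tau (by norm_num) (by norm_num)

end Z4

end Summit.MatrixMultiplication.OmegaCensus
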